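import Mathlib
import HarnessLib
import Summits.QuantumFields.YangMills.Theorems.LangevinControlUVFemtoCurvatureTwoPointMirrorPairCauchySchwarz

/-!
# Crux `FemtoCurvatureTwoPoint` (stmt-QuantumFields-9363, route `LangevinControlUV`):
# the axis covariance profile is log-convex and non-increasing (reflection positivity, part 4 of 4)

Helper for the line `generic-step-gamma-encoding` (lead prover, `--supports stmt-QuantumFields-9363`).
For EVERY compact group `G`, continuous matrix representation `ρ`, torus side `L` and `β ≥ 0`, the axis
profile of the crux `f(s) = Cov_{L,β}(P_0^{01}, P_{s e₂}^{01})` (`P = N − Re tr ρ(U_p)`, indices mod `L`)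
satisfies

* `axisProfile_logConvex`: `f(n)² ≤ f(n−1) f(n+1)` for `1 ≤ n ≤ L − 1` — reflection-positivity
  Cauchy–Schwarz `Cov(F∘Θ, G)² ≤ Cov(F∘Θ, F) Cov(G∘Θ, G)` (tree `RPCauchySchwarz.covariance_rp_cauchySchwarz`)
  for the mirror plaquettes of parts 1–3 (`…MirrorPairCauchySchwarz`): even `L` — link mirror (even `n`) / site mirror (odd `n`);
  odd `L` — odd-torus mirror at separation `n` (even `n`) or `L − n` (odd `n`);
* `axisProfile_antitone` / `axisPlaquetteCov_antitone` (`stub_axisProfileAntitone`, crux coordinates):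
  `f(n) ≤ f(k)` for `k ≤ n ≤ L/2` — from log-convexity, `f ≥ 0` (part 2) and `f(L − s) = f(s)` by
  downward induction from `L/2`.

This is the transfer-matrix ("cosh-mixture") monotonicity of the diagonal profile, obtained from
reflection positivity alone, for all `β ≥ 0` and all `L`; it is the structural input
`stub_profileAntitone` of the sibling line `cosh-mixture-convexity` for the crux's reference family, and
it sandwiches the crux's two-sided clause at separation `n` between its neighbours.
-/

noncomputable section

open MeasureTheory
open Literature.MathematicalPhysics.QuantumFieldTheory

namespace Summit.QuantumFields.YangMills.Theorems.FemtoCurvatureTwoPoint.AxisCovNonneg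

/-! ## The axis profile: log-convexity and monotonicity on `[0, L/2]` -/

section Profile

variable {L N : ℕ} [NeZero L] {G : Type*} [Group G] [TopologicalSpace G]
  [IsTopologicalGroup G] [CompactSpace G] [MeasurableSpace G] [BorelSpace G]
  (ρ : G →* Matrix (Fin N) (Fin N) ℂ)

/-- `Cov(P_0, P_{−x}) = Cov(P_0, P_x)` (translate by `x`, then swap). [folklore] -/
theorem cov_origin_neg {d : ℕ} (β : ℝ) (x : Site d L) (q : {p : Fin d × Fin d // p.1 < p.2}) :
    wilsonExpectation ρ β (fun U : GaugeConfig d L G =>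
        WilsonRP.plaqRe ρ U ((0 : Site d L), q) * WilsonRP.plaqRe ρ U (-x, q))
      - wilsonExpectation ρ β (fun U : GaugeConfig d L G => WilsonRP.plaqRe ρ U ((0 : Site d L), q))
        * wilsonExpectation ρ β (fun U : GaugeConfig d L G => WilsonRP.plaqRe ρ U (-x, q)) =
    wilsonExpectation ρ β (fun U : GaugeConfig d L G =>
        WilsonRP.plaqRe ρ U ((0 : Site d L), q) * WilsonRP.plaqRe ρ U (x, q))
      - wilsonExpectation ρ β (fun U : GaugeConfig d L G => WilsonRP.plaqRe ρ U ((0 : Site d L), q))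
        * wilsonExpectation ρ β (fun U : GaugeConfig d L G => WilsonRP.plaqRe ρ U (x, q)) := by
  rw [cov_translate ρ β 0 (-x) (-x) q, cov_symm]
  simp

/-- A pair `(a, b)` with `b − a = ±x` has the covariance of the pair `(0, x)`. [folklore] -/
theorem cov_pair_eq_origin {d : ℕ} (β : ℝ) {a b x : Site d L} (q : {p : Fin d × Fin d // p.1 < p.2})
    (h : b - a = x ∨ b - a = -x) :
    wilsonExpectation ρ β (fun U : GaugeConfig d L G =>
        WilsonRP.plaqRe ρ U (a, q) * WilsonRP.plaqRe ρ U (b, q))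
      - wilsonExpectation ρ β (fun U : GaugeConfig d L G => WilsonRP.plaqRe ρ U (a, q))
        * wilsonExpectation ρ β (fun U : GaugeConfig d L G => WilsonRP.plaqRe ρ U (b, q)) =
    wilsonExpectation ρ β (fun U : GaugeConfig d L G =>
        WilsonRP.plaqRe ρ U ((0 : Site d L), q) * WilsonRP.plaqRe ρ U (x, q))
      - wilsonExpectation ρ β (fun U : GaugeConfig d L G => WilsonRP.plaqRe ρ U ((0 : Site d L), q))
        * wilsonExpectation ρ β (fun U : GaugeConfig d L G => WilsonRP.plaqRe ρ U (x, q)) := by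
  rw [cov_translate ρ β a b a q, sub_self]
  rcases h with h | h
  · rw [h]
  · rw [h, cov_origin_neg]

/-- **Log-convexity of the axis profile (reflection-positivity Cauchy–Schwarz).** On the torus
`(ℤ/L)^{d+1}`, for every compact `G`, continuous `ρ`, `β ≥ 0`, spatial plane `q` and `1 ≤ n ≤ L − 1`:
`f(n)² ≤ f(n−1) f(n+1)` for the profile `f(s) = Cov(P_0^q, P_{s e₀}^q)` (indices mod `L`). Even `L`:
link mirror (even `n`) / site mirror (odd `n`); odd `L`: odd-torus mirror at `n` (even `n`) or at
`L − n` (odd `n`). [folklore] -/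
theorem axisProfile_logConvex {d : ℕ} (hρ : Continuous ρ) {β : ℝ} (hβ : 0 ≤ β)
    (q : {p : Fin (d + 1) × Fin (d + 1) // p.1 < p.2}) (hq : q.1.1 ≠ 0) (f : ℕ → ℝ)
    (hf : f = fun s => wilsonExpectation ρ β (fun U : GaugeConfig (d + 1) L G =>
        WilsonRP.plaqRe ρ U ((0 : Site (d + 1) L), q) *
          WilsonRP.plaqRe ρ U ((Pi.single (0 : Fin (d + 1)) ((s : ℕ) : ZMod L) : Site (d + 1) L), q))
      - wilsonExpectation ρ β (fun U : GaugeConfig (d + 1) L G =>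
          WilsonRP.plaqRe ρ U ((0 : Site (d + 1) L), q))
        * wilsonExpectation ρ β (fun U : GaugeConfig (d + 1) L G =>
          WilsonRP.plaqRe ρ U ((Pi.single (0 : Fin (d + 1)) ((s : ℕ) : ZMod L) : Site (d + 1) L), q)))
    {n : ℕ} (hn1 : 1 ≤ n) (hnL : n + 1 ≤ L) : f n ^ 2 ≤ f (n - 1) * f (n + 1) := by
  -- covariance of a pair `(single 0 c, single 0 c')` in terms of `f`
  have hpair : ∀ (c c' : ZMod L) (m : ℕ), (c' - c = (m : ZMod L) ∨ c' - c = -(m : ZMod L)) →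
      wilsonExpectation ρ β (fun U : GaugeConfig (d + 1) L G =>
          WilsonRP.plaqRe ρ U ((Pi.single (0 : Fin (d + 1)) c : Site (d + 1) L), q) *
            WilsonRP.plaqRe ρ U ((Pi.single (0 : Fin (d + 1)) c' : Site (d + 1) L), q))
        - wilsonExpectation ρ β (fun U : GaugeConfig (d + 1) L G =>
            WilsonRP.plaqRe ρ U ((Pi.single (0 : Fin (d + 1)) c : Site (d + 1) L), q))
          * wilsonExpectation ρ β (fun U : GaugeConfig (d + 1) L G =>
            WilsonRP.plaqRe ρ U ((Pi.single (0 : Fin (d + 1)) c' : Site (d + 1) L), q)) = f m := by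
    intro c c' m hm
    rw [hf]
    refine cov_pair_eq_origin ρ β q ?_
    rcases hm with hm | hm
    · left; rw [← Pi.single_sub, hm]
    · right; rw [← Pi.single_sub, hm, Pi.single_neg]
  have hL0 : 0 < L := Nat.pos_of_ne_zero (NeZero.ne L)
  rcases Nat.even_or_odd L with hL | hL
  · -- even torus
    obtain ⟨r, hr⟩ := hL
    rcases Nat.even_or_odd n with hn | hn
    · -- even `n = 2k`: link mirror with `a = k`, `b = k + 1`
      obtain ⟨k, rfl⟩ := hn
      have hk1 : 1 ≤ k := by omega
      have hkL : k < L := by omega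
      have hk1L : k + 1 < L := by omega
      set p : Plaquette (d + 1) L := ((Pi.single (0 : Fin (d + 1)) ((k : ℕ) : ZMod L)), q) with hp
      set p' : Plaquette (d + 1) L := ((Pi.single (0 : Fin (d + 1)) (((k + 1 : ℕ) : ℕ) : ZMod L)), q)
        with hp'
      have hv : (p.1 0).val = k := by simp only [hp]; exact val_single_zero hkL
      have hv' : (p'.1 0).val = k + 1 := by simp only [hp']; exact val_single_zero hk1L
      have h := cov_timeReflect_sq_le_even ρ ⟨r, hr⟩ hρ hβ (p := p) (p' := p') hq (by omega)
        (by omega) hq (by omega) (by omega)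
      simp only [hp, hp', timeReflect_single] at h
      rw [hpair _ _ (k + k) (Or.inl (by push_cast; ring)),
        hpair _ _ (k + k - 1) (Or.inl ?_), hpair _ _ (k + k + 1) (Or.inl (by push_cast; ring))] at h
      · exact h
      · have : k + k - 1 + 1 = k + k := by omega
        have e : ((k + k - 1 : ℕ) : ZMod L) + 1 = (k : ZMod L) + k := by exact_mod_cast congrArg (fun x : ℕ => (x : ZMod L)) this
        linear_combination -e
    · -- odd `n = 2k+1`: site mirror with `a = k`, `b = k + 1`
      obtain ⟨k, rfl⟩ := hn
      have hkL : k < L := by omega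
      have hk1L : k + 1 < L := by omega
      set p : Plaquette (d + 1) L := ((Pi.single (0 : Fin (d + 1)) ((k : ℕ) : ZMod L)), q) with hp
      set p' : Plaquette (d + 1) L := ((Pi.single (0 : Fin (d + 1)) (((k + 1 : ℕ) : ℕ) : ZMod L)), q)
        with hp'
      have hv : (p.1 0).val = k := by simp only [hp]; exact val_single_zero hkL
      have hv' : (p'.1 0).val = k + 1 := by simp only [hp']; exact val_single_zero hk1L
      have h := cov_negReflect_sq_le ρ ⟨r, hr⟩ hρ β (p := p) (p' := p') hq (by omega) hq (by omega)
      simp only [hp, hp', negReflect_single] at h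
      rw [hpair _ _ (2 * k + 1) (Or.inl (by push_cast; ring)),
        hpair _ _ (2 * k + 1 - 1) (Or.inl (by push_cast [show 1 ≤ 2 * k + 1 by omega]; ring)),
        hpair _ _ (2 * k + 1 + 1) (Or.inl (by push_cast; ring))] at h
      exact h
  · -- odd torus, `L = 2r+1 ≥ 3`
    obtain ⟨r, hr⟩ := hL
    have hL3 : 3 ≤ L := by omega
    rcases Nat.even_or_odd n with hn | hn
    · -- even `n = 2k`: odd-torus mirror with `a = k`, `b = k + 1`
      obtain ⟨k, rfl⟩ := hn
      have hk1 : 1 ≤ k := by omega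
      have hkL : k < L := by omega
      have hk1L : k + 1 < L := by omega
      set p : Plaquette (d + 1) L := ((Pi.single (0 : Fin (d + 1)) ((k : ℕ) : ZMod L)), q) with hp
      set p' : Plaquette (d + 1) L := ((Pi.single (0 : Fin (d + 1)) (((k + 1 : ℕ) : ℕ) : ZMod L)), q)
        with hp'
      have hv : (p.1 0).val = k := by simp only [hp]; exact val_single_zero hkL
      have hv' : (p'.1 0).val = k + 1 := by simp only [hp']; exact val_single_zero hk1L
      have h := cov_timeReflect_sq_le_odd ρ ⟨r, hr⟩ hL3 hρ hβ (p := p) (p' := p') hq (by omega)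
        (by omega) hq (by omega) (by omega)
      simp only [hp, hp', timeReflect_single] at h
      rw [hpair _ _ (k + k) (Or.inl (by push_cast; ring)),
        hpair _ _ (k + k - 1) (Or.inl ?_), hpair _ _ (k + k + 1) (Or.inl (by push_cast; ring))] at h
      · exact h
      · have : k + k - 1 + 1 = k + k := by omega
        have e : ((k + k - 1 : ℕ) : ZMod L) + 1 = (k : ZMod L) + k := by exact_mod_cast congrArg (fun x : ℕ => (x : ZMod L)) this
        linear_combination -e
    · -- odd `n = 2k+1`: odd-torus mirror at separation `L − n`, `a = r − k + 1`, `b = r − k`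
      obtain ⟨k, rfl⟩ := hn
      have hkr : k + 1 ≤ r := by omega
      have haL : r - k + 1 < L := by omega
      have hbL : r - k < L := by omega
      set p : Plaquette (d + 1) L := ((Pi.single (0 : Fin (d + 1)) (((r - k + 1 : ℕ) : ℕ) : ZMod L)), q)
        with hp
      set p' : Plaquette (d + 1) L := ((Pi.single (0 : Fin (d + 1)) (((r - k : ℕ) : ℕ) : ZMod L)), q)
        with hp'
      have hv : (p.1 0).val = r - k + 1 := by simp only [hp]; exact val_single_zero haL
      have hv' : (p'.1 0).val = r - k := by simp only [hp']; exact val_single_zero hbL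
      have h := cov_timeReflect_sq_le_odd ρ ⟨r, hr⟩ hL3 hρ hβ (p := p) (p' := p') hq (by omega)
        (by omega) hq (by omega) (by omega)
      simp only [hp, hp', timeReflect_single] at h
      have hL' : ((2 * r + 1 : ℕ) : ZMod L) = 0 := by rw [← hr]; exact ZMod.natCast_self L
      have hkr' : k ≤ r := by omega
      push_cast [Nat.cast_sub hkr'] at hL' h
      rw [hpair _ _ (2 * k + 1) (Or.inr (by push_cast; linear_combination hL')),
        hpair _ _ (2 * k + 1 - 1) (Or.inr (by
          push_cast [show 1 ≤ 2 * k + 1 by omega]; linear_combination hL')),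
        hpair _ _ (2 * k + 1 + 1) (Or.inr (by push_cast; linear_combination hL'))] at h
      exact h

/-- **The axis profile is non-increasing on `[0, L/2]`.** On the torus `(ℤ/L)^{d+1}`, for every
compact `G`, continuous `ρ`, `β ≥ 0` and spatial plane `q`: `f(n) ≤ f(k)` for `k ≤ n ≤ L/2`, where
`f(s) = Cov(P_0^q, P_{s e₀}^q)`. From log-convexity (`axisProfile_logConvex`), non-negativity
(`timeAxisCov_nonneg`) and the symmetry `f(L − s) = f(s)`, by downward induction from `L/2`. [folklore] -/
theorem axisProfile_antitone {d : ℕ} (hρ : Continuous ρ) {β : ℝ} (hβ : 0 ≤ β)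
    (q : {p : Fin (d + 1) × Fin (d + 1) // p.1 < p.2}) (hq : q.1.1 ≠ 0) (f : ℕ → ℝ)
    (hf : f = fun s => wilsonExpectation ρ β (fun U : GaugeConfig (d + 1) L G =>
        WilsonRP.plaqRe ρ U ((0 : Site (d + 1) L), q) *
          WilsonRP.plaqRe ρ U ((Pi.single (0 : Fin (d + 1)) ((s : ℕ) : ZMod L) : Site (d + 1) L), q))
      - wilsonExpectation ρ β (fun U : GaugeConfig (d + 1) L G =>
          WilsonRP.plaqRe ρ U ((0 : Site (d + 1) L), q))
        * wilsonExpectation ρ β (fun U : GaugeConfig (d + 1) L G =>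
          WilsonRP.plaqRe ρ U ((Pi.single (0 : Fin (d + 1)) ((s : ℕ) : ZMod L) : Site (d + 1) L), q)))
    {k n : ℕ} (hkn : k ≤ n) (hn : 2 * n ≤ L) : f n ≤ f k := by
  have hnn : ∀ s, 0 ≤ f s := fun s => by
    rw [hf]
    exact timeAxisCov_nonneg ρ hρ hβ q hq s
  have hsym : ∀ s, s ≤ L → f (L - s) = f s := fun s hs => by
    rw [hf]
    simp only
    have e : (((L - s : ℕ) : ℕ) : ZMod L) = -((s : ℕ) : ZMod L) := by
      rw [Nat.cast_sub hs, ZMod.natCast_self, zero_sub]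
    rw [e, Pi.single_neg]
    exact cov_origin_neg ρ β _ q
  have hlc : ∀ m, 1 ≤ m → m + 1 ≤ L → f m ^ 2 ≤ f (m - 1) * f (m + 1) := fun m h1 h2 =>
    axisProfile_logConvex ρ hρ hβ q hq f hf h1 h2
  -- from `f(m+1)² ≤ f(m) f(m+1)` to `f(m+1) ≤ f(m)`
  have hdiv : ∀ m, f (m + 1) ^ 2 ≤ f m * f (m + 1) → f (m + 1) ≤ f m := fun m h => by
    by_cases h0 : f (m + 1) = 0
    · rw [h0]; exact hnn m
    · have hpos : 0 < f (m + 1) := lt_of_le_of_ne (hnn _) (Ne.symm h0)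
      refine le_of_mul_le_mul_right ?_ hpos
      nlinarith [h]
  -- one step down, by downward induction from `L/2`
  have hstep : ∀ j m, m + 1 + j = L / 2 → f (m + 1) ≤ f m := by
    intro j
    induction j with
    | zero =>
      intro m hm
      have h := hlc (m + 1) (by omega) (by omega)
      simp only [Nat.add_sub_cancel] at h
      rcases Nat.even_or_odd L with hL | hL
      · -- `L = 2(m+1)`: `f(m+2) = f(L - m) = f(m)`, so `f(m+1)² ≤ f(m)²`
        obtain ⟨r, hr⟩ := hL
        have e : f (m + 1 + 1) = f m := by
          rw [show m + 1 + 1 = L - m by omega]; exact hsym m (by omega)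
        rw [e, ← sq] at h
        exact (pow_le_pow_iff_left₀ (hnn _) (hnn _) two_ne_zero).1 h
      · -- `L = 2(m+1) + 1`: `f(m+2) = f(L - (m+1)) = f(m+1)`
        obtain ⟨r, hr⟩ := hL
        have e : f (m + 1 + 1) = f (m + 1) := by
          rw [show m + 1 + 1 = L - (m + 1) by omega]; exact hsym (m + 1) (by omega)
        rw [e] at h
        exact hdiv m h
    | succ j ih =>
      intro m hm
      have hnext : f (m + 1 + 1) ≤ f (m + 1) := ih (m + 1) (by omega)
      have h := hlc (m + 1) (by omega) (by omega)
      simp only [Nat.add_sub_cancel] at h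
      exact hdiv m (h.trans (mul_le_mul_of_nonneg_left hnext (hnn m)))
  -- chain the steps from `k` to `n`
  induction n, hkn using Nat.le_induction with
  | base => exact le_rfl
  | succ n hkn' ih =>
    have h1 : f (n + 1) ≤ f n := hstep (L / 2 - (n + 1)) n (by omega)
    exact h1.trans (ih (by omega))

/-- **The crux's axis profile is non-increasing on `[0, L/2]`.** For every compact `G`, continuous
`ρ`, torus `(ℤ/L)⁴`, `β ≥ 0` and `k ≤ n ≤ L/2`:
`Cov_{L,β}(P_0^{01}, P_{n e₂}^{01}) ≤ Cov_{L,β}(P_0^{01}, P_{k e₂}^{01})` (crux's `P = N − Re tr ρ(U_p)`).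
In particular `Cov(P_0^{01}, P_{ne₂}^{01}) ≤ Var P^{01}` and the two-sided clause of the crux at `n`
is squeezed between its neighbours: transfer-matrix monotonicity proved by reflection positivity
alone (no spectral theory). [folklore] -/
theorem axisPlaquetteCov_antitone (hρ : Continuous ρ) {β : ℝ} (hβ : 0 ≤ β) {k n : ℕ} (hkn : k ≤ n)
    (hn : 2 * n ≤ L) :
    wilsonExpectation ρ β (fun U : GaugeConfig 4 L G =>
          ((N : ℝ) - (ρ (plaquetteHolonomy U 0 0 1)).trace.re) *
            ((N : ℝ) - (ρ (plaquetteHolonomy U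
              (Pi.single (2 : Fin 4) ((n : ℕ) : ZMod L)) 0 1)).trace.re))
        - wilsonExpectation ρ β (fun U : GaugeConfig 4 L G =>
            (N : ℝ) - (ρ (plaquetteHolonomy U 0 0 1)).trace.re)
          * wilsonExpectation ρ β (fun U : GaugeConfig 4 L G =>
            (N : ℝ) - (ρ (plaquetteHolonomy U
              (Pi.single (2 : Fin 4) ((n : ℕ) : ZMod L)) 0 1)).trace.re) ≤
    wilsonExpectation ρ β (fun U : GaugeConfig 4 L G =>
          ((N : ℝ) - (ρ (plaquetteHolonomy U 0 0 1)).trace.re) *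
            ((N : ℝ) - (ρ (plaquetteHolonomy U
              (Pi.single (2 : Fin 4) ((k : ℕ) : ZMod L)) 0 1)).trace.re))
        - wilsonExpectation ρ β (fun U : GaugeConfig 4 L G =>
            (N : ℝ) - (ρ (plaquetteHolonomy U 0 0 1)).trace.re)
          * wilsonExpectation ρ β (fun U : GaugeConfig 4 L G =>
            (N : ℝ) - (ρ (plaquetteHolonomy U
              (Pi.single (2 : Fin 4) ((k : ℕ) : ZMod L)) 0 1)).trace.re) := by
  rw [cruxAxisCov_eq ρ hρ β n, cruxAxisCov_eq ρ hρ β k]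
  exact axisProfile_antitone (L := L) (d := 3) ρ hρ hβ _ (by decide) _ rfl hkn hn

end Profile

end Summit.QuantumFields.YangMills.Theorems.FemtoCurvatureTwoPoint.AxisCovNonneg

namespace Summit.QuantumFields.YangMills.Theorems.FemtoCurvatureTwoPoint

/-- **Registered sub-goal `stub_axisProfileAntitone`** (`--supports stmt-QuantumFields-9363`): the
crux's axis covariance profile is non-increasing on `[0, L/2]` for every compact `G`, continuous `ρ`,
torus side `L` and `β ≥ 0` (closed form of `AxisCovNonneg.axisPlaquetteCov_antitone`, fully qualified).
[folklore] -/
theorem stub_axisProfileAntitone : ∀ (L N : ℕ) [NeZero L] (G : Type) [Group G] [TopologicalSpace G] [IsTopologicalGroup G] [CompactSpace G] [MeasurableSpace G] [BorelSpace G] (ρ : G →* Matrix (Fin N) (Fin N) ℂ), Continuous ρ → ∀ (β : ℝ), 0 ≤ β → ∀ (k n : ℕ), k ≤ n → 2 * n ≤ L → Literature.MathematicalPhysics.QuantumFieldTheory.wilsonExpectation ρ β (fun U : Literature.MathematicalPhysics.QuantumFieldTheory.GaugeConfig 4 L G => ((N : ℝ) - (ρ (Literature.MathematicalPhysics.QuantumFieldTheory.plaquetteHolonomy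 U 0 0 1)).trace.re) * ((N : ℝ) - (ρ (Literature.MathematicalPhysics.QuantumFieldTheory.plaquetteHolonomy U (Pi.single (2 : Fin 4) ((n : ℕ) : ZMod L)) 0 1)).trace.re)) - Literature.MathematicalPhysics.QuantumFieldTheory.wilsonExpectation ρ β (fun U : Literature.MathematicalPhysics.QuantumFieldTheory.GaugeConfig 4 L G => (N : ℝ) - (ρ (Literature.MathematicalPhysics.QuantumFieldTheory.plaquetteHolonomy U 0 0 1)).trace.re) * Literature.MathematicalPhysics.QuantumFieldTheory.wilsonExpectation ρ β (fun U : Literature.MathematicalPhysics.QuantumFieldTheory.GaugeConfig 4 L G => (N : ℝ) - (ρ (Literature.MathematicalPhysics.QuantumFieldTheory.plaquetteHolonomy U (Pi.single (2 : Fin 4) ((n : ℕ) : ZMod L)) 0 1)).trace.re) ≤ Literature.MathematicalPhysics.QuantumFieldTheory.wilsonExpectation ρ β (fun U : Literature.MathematicalPhysics.QuantumFieldTheory.GaugeConfig 4 L G => ((N : ℝ) - (ρ (Literature.MathematicalPhysics.QuantumFieldTheory.plaquetteHolonomy U 0 0 1)).trace.re) * ((N : ℝ) - (ρ (Literature.MathematicalPhysics.QuantumFieldTheory.plaquetteHolonomy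 U (Pi.single (2 : Fin 4) ((k : ℕ) : ZMod L)) 0 1)).trace.re)) - Literature.MathematicalPhysics.QuantumFieldTheory.wilsonExpectation ρ β (fun U : Literature.MathematicalPhysics.QuantumFieldTheory.GaugeConfig 4 L G => (N : ℝ) - (ρ (Literature.MathematicalPhysics.QuantumFieldTheory.plaquetteHolonomy U 0 0 1)).trace.re) * Literature.MathematicalPhysics.QuantumFieldTheory.wilsonExpectation ρ β (fun U : Literature.MathematicalPhysics.QuantumFieldTheory.GaugeConfig 4 L G => (N : ℝ) - (ρ (Literature.MathematicalPhysics.QuantumFieldTheory.plaquetteHolonomy U (Pi.single (2 : Fin 4) ((k : ℕ) : ZMod L)) 0 1)).trace.re) := by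
  intro L N _ G _ _ _ _ _ _ ρ hρ β hβ k n hkn hn
  exact AxisCovNonneg.axisPlaquetteCov_antitone ρ hρ hβ hkn hn

end Summit.QuantumFields.YangMills.Theorems.FemtoCurvatureTwoPoint

end
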